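import Mathlib.Combinatorics.SetFamily.LYM
import Literature.Combinatorics.SetFamily.BiasedMeasure
import Summits.PneNP.PneNP.Theorems.OneSliceSliceACZeroDefs

/-!
# Route OneSlice, item `ShallowSliceBound` (stmt-PneNP-14083): Hamming slices of a finite cube

Helper file (prover seat, 2026-08-16), stated over the landed vocabulary only (`wt`, `sliceAvg` of
`Theorems/OneSliceSliceACZeroDefs.lean`, `finsetEquivFun` of `Literature/Combinatorics/SetFamily`; no new
definition). Counting on the slices `{x : |x| = ℓ}` of a cube `ι → Bool`:

* `card_slice_eq_choose` (`#slice_ℓ = C(N, ℓ)`), `card_acc_le_card_slice`, `sliceAvg_nonneg`, `sliceAvg_le_one`;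
* `sliceAvg_le_succ` / `sliceAvg_mono` / `card_acc_mul_le` — for a MONOTONE `g` the slice averages `a_ℓ(g)` are
  non-decreasing in `ℓ` (local LYM inequality applied to the down-closed family of zeros, Mathlib's
  `Finset.local_lubell_yamamoto_meshalkin_inequality_div`).
-/

set_option linter.dupNamespace false

noncomputable section

namespace Summit.PneNP.PneNP.Theorems.ShallowSliceBound

open Finset
open Summit.PneNP.PneNP.Cruxes.SliceACZero.RussoWindowLadder (wt sliceAvg)
open Literature.Combinatorics.SetFamily (finsetEquivFun mem_finsetEquivFun_symm)

variable {ι : Type} [Fintype ι] [DecidableEq ι]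

/-- The weight of a point is the cardinality of its support. [folklore] -/
theorem wt_eq_card_symm (x : ι → Bool) : wt x = #(finsetEquivFun.symm x) := rfl

/-- The weight of an indicator is the cardinality. [folklore] -/
theorem wt_finsetEquivFun (S : Finset ι) : wt (finsetEquivFun S) = #S := by
  rw [wt_eq_card_symm, Equiv.symm_apply_apply]

/-- `#slice_ℓ = C(N, ℓ)`. [folklore] -/
theorem card_slice_eq_choose (ℓ : ℕ) :
    #(univ.filter fun x : ι → Bool => wt x = ℓ) = (Fintype.card ι).choose ℓ := by
  rw [← card_univ, ← card_powersetCard]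
  refine card_equiv (finsetEquivFun (α := ι)).symm fun x => ?_
  simp only [mem_filter, mem_univ, true_and, mem_powersetCard, subset_univ, wt_eq_card_symm]

/-- Slices `ℓ ≤ N` are non-empty. [folklore] -/
theorem card_slice_pos {ℓ : ℕ} (h : ℓ ≤ Fintype.card ι) : 0 < #(univ.filter fun x : ι → Bool => wt x = ℓ) := by
  rw [card_slice_eq_choose]; exact Nat.choose_pos h

/-- `#acc_ℓ ≤ #slice_ℓ`. [folklore] -/
theorem card_acc_le_card_slice (g : (ι → Bool) → Bool) (ℓ : ℕ) :
    #(univ.filter fun x : ι → Bool => wt x = ℓ ∧ g x = true) ≤ #(univ.filter fun x : ι → Bool => wt x = ℓ) :=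
  card_le_card fun x hx => by
    rw [mem_filter] at hx ⊢
    exact ⟨hx.1, hx.2.1⟩

/-- Slice averages lie in `[0, 1]`. [folklore] -/
theorem sliceAvg_nonneg (g : (ι → Bool) → Bool) (ℓ : ℕ) : 0 ≤ sliceAvg g ℓ := by
  rw [sliceAvg]; positivity

/-- Slice averages lie in `[0, 1]`. [folklore] -/
theorem sliceAvg_le_one (g : (ι → Bool) → Bool) (ℓ : ℕ) : sliceAvg g ℓ ≤ 1 := by
  rw [sliceAvg]
  rcases Nat.eq_zero_or_pos #(univ.filter fun x : ι → Bool => wt x = ℓ) with h | h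
  · rw [h]; simp
  · rw [div_le_one (by exact_mod_cast h)]; exact_mod_cast card_acc_le_card_slice g ℓ

/-- The number of zeros of `g` on a slice. [folklore] -/
theorem card_zeros_eq (g : (ι → Bool) → Bool) (ℓ : ℕ) :
    #(univ.filter fun x : ι → Bool => wt x = ℓ ∧ g x = false) =
      #(univ.filter fun x : ι → Bool => wt x = ℓ) - #(univ.filter fun x : ι → Bool => wt x = ℓ ∧ g x = true) := by
  have h := Finset.card_filter_add_card_filter_not (s := univ.filter fun x : ι → Bool => wt x = ℓ)
    (fun x => g x = true)
  rw [filter_filter, filter_filter] at h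
  have h2 : (univ.filter fun x : ι → Bool => wt x = ℓ ∧ ¬ g x = true) =
      univ.filter fun x : ι → Bool => wt x = ℓ ∧ g x = false := by
    refine filter_congr fun x _ => ?_; simp
  rw [h2] at h
  omega

/-- The supports of the zeros of `g` on slice `r` form an `r`-sized family. [folklore] -/
theorem sized_zeros (g : (ι → Bool) → Bool) (r : ℕ) :
    (((powersetCard r (univ : Finset ι)).filter fun S => g (finsetEquivFun S) = false : Finset (Finset ι)) :
      Set (Finset ι)).Sized r := by
  intro S hS
  rw [mem_coe, mem_filter, mem_powersetCard] at hS
  exact hS.1.2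

/-- The supports of the zeros count the zeros. [folklore] -/
theorem card_zeros_supports (g : (ι → Bool) → Bool) (r : ℕ) :
    #((powersetCard r (univ : Finset ι)).filter fun S => g (finsetEquivFun S) = false) =
      #(univ.filter fun x : ι → Bool => wt x = r) - #(univ.filter fun x : ι → Bool => wt x = r ∧ g x = true) := by
  rw [← card_zeros_eq]
  refine card_equiv (finsetEquivFun (α := ι)) fun S => ?_
  simp only [mem_filter, mem_powersetCard, subset_univ, true_and, mem_univ, wt_finsetEquivFun]

/-- For a monotone `g` the shadow of the zeros on slice `r + 1` consists of zeros on slice `r`. [folklore] -/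
theorem shadow_zeros_subset {g : (ι → Bool) → Bool} (hg : Monotone g) (r : ℕ) :
    Finset.shadow ((powersetCard (r + 1) (univ : Finset ι)).filter fun S => g (finsetEquivFun S) = false) ⊆
      (powersetCard r (univ : Finset ι)).filter fun S => g (finsetEquivFun S) = false := by
  intro S hS
  rw [Finset.mem_shadow_iff] at hS
  obtain ⟨T, hT, e, he, rfl⟩ := hS
  rw [mem_filter, mem_powersetCard] at hT ⊢
  refine ⟨⟨subset_univ _, by rw [card_erase_of_mem he, hT.1.2]; rfl⟩, ?_⟩
  have hle : finsetEquivFun (T.erase e) ≤ finsetEquivFun T := by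
    intro i
    simp only [finsetEquivFun, Equiv.coe_fn_mk]
    by_cases hi : i ∈ T.erase e
    · have : i ∈ T := mem_of_mem_erase hi
      simp [hi, this]
    · simp [hi]
  have := hg hle
  rw [hT.2] at this
  revert this
  cases g (finsetEquivFun (T.erase e)) <;> simp

/-- **Monotone functions have non-decreasing slice averages** (one step): for monotone `g` and `r + 1 ≤ N`,
`a_r(g) ≤ a_{r+1}(g)` — the local LYM inequality for the down-closed family of zeros. [folklore] -/
theorem sliceAvg_le_succ {g : (ι → Bool) → Bool} (hg : Monotone g) {r : ℕ} (hr : r + 1 ≤ Fintype.card ι) :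
    sliceAvg g r ≤ sliceAvg g (r + 1) := by
  have hlym := Finset.local_lubell_yamamoto_meshalkin_inequality_div (𝕜 := ℝ) (Nat.succ_ne_zero r)
    (sized_zeros g (r + 1))
  simp only [Nat.succ_sub_one] at hlym
  have hsh := card_le_card (shadow_zeros_subset hg r)
  have hsh' : (#(Finset.shadow ((powersetCard (r + 1) (univ : Finset ι)).filter
      fun S => g (finsetEquivFun S) = false)) : ℝ) ≤
      #((powersetCard r (univ : Finset ι)).filter fun S => g (finsetEquivFun S) = false) := by
    exact_mod_cast hsh
  have hpos0 : (0 : ℝ) < (Fintype.card ι).choose r := by exact_mod_cast Nat.choose_pos (by omega)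
  have hpos1 : (0 : ℝ) < (Fintype.card ι).choose (r + 1) := by exact_mod_cast Nat.choose_pos hr
  have h1 := hlym.trans (div_le_div_of_nonneg_right hsh' hpos0.le)
  rw [card_zeros_supports, card_zeros_supports, Nat.cast_sub (card_acc_le_card_slice g _),
    Nat.cast_sub (card_acc_le_card_slice g _), card_slice_eq_choose, card_slice_eq_choose] at h1
  rw [sliceAvg, sliceAvg, card_slice_eq_choose, card_slice_eq_choose]
  rw [sub_div, sub_div, div_self hpos0.ne', div_self hpos1.ne'] at h1
  linarith

/-- **Monotone functions have non-decreasing slice averages**: `a_ℓ(g) ≤ a_{ℓ'}(g)` for `ℓ ≤ ℓ' ≤ N`. [folklore] -/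
theorem sliceAvg_mono {g : (ι → Bool) → Bool} (hg : Monotone g) {ℓ ℓ' : ℕ} (hℓ : ℓ ≤ ℓ')
    (hℓ' : ℓ' ≤ Fintype.card ι) : sliceAvg g ℓ ≤ sliceAvg g ℓ' := by
  induction ℓ', hℓ using Nat.le_induction with
  | base => exact le_rfl
  | succ k hk ih => exact (ih (by omega)).trans (sliceAvg_le_succ hg hℓ')

/-- Cross-multiplied monotonicity: `#acc_ℓ · #slice_{ℓ'} ≤ #acc_{ℓ'} · #slice_ℓ` for `ℓ ≤ ℓ' ≤ N`. [folklore] -/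
theorem card_acc_mul_le {g : (ι → Bool) → Bool} (hg : Monotone g) {ℓ ℓ' : ℕ} (hℓ : ℓ ≤ ℓ')
    (hℓ' : ℓ' ≤ Fintype.card ι) :
    (#(univ.filter fun x : ι → Bool => wt x = ℓ ∧ g x = true) : ℝ) * #(univ.filter fun x : ι → Bool => wt x = ℓ') ≤
      (#(univ.filter fun x : ι → Bool => wt x = ℓ' ∧ g x = true) : ℝ) * #(univ.filter fun x : ι → Bool => wt x = ℓ) := by
  have h := sliceAvg_mono hg hℓ hℓ'
  rw [sliceAvg, sliceAvg] at h
  have hp : (0 : ℝ) < #(univ.filter fun x : ι → Bool => wt x = ℓ) := by exact_mod_cast card_slice_pos (hℓ.trans hℓ')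
  have hp' : (0 : ℝ) < #(univ.filter fun x : ι → Bool => wt x = ℓ') := by exact_mod_cast card_slice_pos hℓ'
  rw [div_le_div_iff₀ hp hp'] at h
  linarith

/-- **Registered form** (sub-goal `sliceAvg_monotone` of stmt-PneNP-14083): monotone functions have
non-decreasing slice averages, all binders explicit. [folklore] -/
theorem sliceAvg_monotone :
    ∀ (ι : Type) [Fintype ι] [DecidableEq ι] (g : (ι → Bool) → Bool), Monotone g → ∀ ℓ ℓ' : ℕ, ℓ ≤ ℓ' →
      ℓ' ≤ Fintype.card ι → sliceAvg g ℓ ≤ sliceAvg g ℓ' :=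
  fun _ _ _ _ hg _ _ hℓ hℓ' => sliceAvg_mono hg hℓ hℓ'

end Summit.PneNP.PneNP.Theorems.ShallowSliceBound

end
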